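import Literature.AlgebraicGeometry.Resolution.DifferentialOperators
import Mathlib.Algebra.MvPolynomial.Basic
import Mathlib.RingTheory.Polynomial.Basic
import Mathlib.RingTheory.Noetherian.Basic
import Mathlib.RingTheory.Finiteness.Basic
import Mathlib.Data.Finsupp.Weight
import HarnessLib

/-!
# `Diff^{≤ m}` of a polynomial ring in finitely many variables is finitely generated

Topic: `Literature/AlgebraicGeometry/Resolution` (companion of `DifferentialOperators.lean` — Grothendieck's
`IsDiffOpLE` / `diffOp`, EGA IV₄ 16.8.8 (b) — of `HasseSchmidtDerivatives.lean` (the `D^{(α)}` lie in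
`Diff^{≤ |α|}`) and of `PolynomialDiffOpOrder.lean` (the one-variable exact-order facts)). For the polynomial ring
`A = K[x_i : i ∈ σ]`:

* `eq_zero_of_isDiffOpLE_of_apply_monomial_eq_zero`: **a differential operator of order `≤ m` that vanishes on all
  monomials `x^β` with `|β| ≤ m` is zero** (induction on `m` through the commutators `[E, x_i]`, then
  `E (x_i t) = x_i · E t` and `K`-linearity) — the uniqueness half of EGA IV₄ Thm. 16.11.2 («les `D_q`, `|q| ≤ m`,
  forment une base du `𝒪_U`-Module `Diff^m`»: an operator of order `≤ m` is determined by its values on the `z^q`,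
  `|q| ≤ m`);
* `fg_of_le_diffOp_mvPolynomial`, `diffOp_mvPolynomial_fg`: for `σ` finite and `K` Noetherian, **every
  `A`-submodule of `Diff^{≤ m}_{A/K}` is finitely generated**, in particular `Diff^{≤ m}_{A/K}` itself (evaluation at
  the monomials `x^β`, `β ≤ m` coordinatewise, embeds `Diff^{≤ m}` `A`-linearly into a finite free `A`-module).

What is NOT here: the basis theorem (freeness of `Diff^{≤ m}` on the `D^{(α)}`), named in `HasseSchmidtDerivatives.lean`
as `hasseSchmidtDiff_eq_diffOp`; smooth algebras other than polynomial rings.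

Source: [EGAIV4] A. Grothendieck, J. Dieudonné, ÉGA IV₄, Publ. Math. IHÉS 32 (1967), Déf. 16.8.1, Prop. 16.8.8,
Thm. 16.11.2.
-/

noncomputable section

open MvPolynomial

namespace Literature.AlgebraicGeometry.Resolution

section AffineSpace

variable {σ : Type*} {K : Type*} [CommRing K]

/-- `x_i · x^β = x^{e_i + β}`. [cite: EGAIV4, Thm. 16.11.2 (notation z^q)] -/
theorem X_mul_monomial_one (i : σ) (β : σ →₀ ℕ) :
    (X i : MvPolynomial σ K) * monomial β 1 = monomial (Finsupp.single i 1 + β) 1 := by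
  rw [monomial_single_add, pow_one]

/-- **An operator of order `≤ m` on `K[x_i : i ∈ σ]` that kills every monomial `x^β` with `|β| ≤ m` is zero.**
[cite: EGAIV4, Thm. 16.11.2 (an operator of order ≤ m is Σ_{|q| ≤ m} a_q D_q, determined by its values on the z^q, |q| ≤ m)] -/
theorem eq_zero_of_isDiffOpLE_of_apply_monomial_eq_zero :
    ∀ (m : ℕ) {E : MvPolynomial σ K →ₗ[K] MvPolynomial σ K}, IsDiffOpLE K m E →
      (∀ β : σ →₀ ℕ, β.degree ≤ m → E (monomial β 1) = 0) → E = 0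
  | 0, E, hE, h0 => by
    rw [isDiffOpLE_zero_iff_eq_mulLeft.1 hE]
    have h1 : E 1 = 0 := by simpa using h0 0 (by simp)
    rw [h1]
    exact LinearMap.mulLeft_zero_eq_zero _ _
  | m + 1, E, hE, h0 => by
    -- every commutator `[E, x_i]` has order `≤ m` and kills the monomials of degree `≤ m`, hence vanishes
    have hF : ∀ i : σ, commMul K E (X i) = 0 := fun i =>
      eq_zero_of_isDiffOpLE_of_apply_monomial_eq_zero m (hE (X i)) fun β hβ => by
        have hdeg : (Finsupp.single i 1 + β).degree ≤ m + 1 := by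
          rw [map_add, Finsupp.degree_single]; omega
        rw [commMul_apply, X_mul_monomial_one, h0 _ hdeg, h0 β (by omega), mul_zero, sub_zero]
    have hX : ∀ (i : σ) (t : MvPolynomial σ K), E (X i * t) = X i * E t := fun i t => by
      have := congrArg (fun D : MvPolynomial σ K →ₗ[K] MvPolynomial σ K => D t) (hF i)
      simpa [commMul_apply, sub_eq_zero] using this
    have h1 : E 1 = 0 := by simpa using h0 0 (by simp)
    refine LinearMap.ext fun f => ?_
    rw [LinearMap.zero_apply]
    induction f using MvPolynomial.induction_on with
    | C a => rw [C_eq_smul_one, map_smul, h1, smul_zero]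
    | add f g hf hg => rw [map_add, hf, hg, add_zero]
    | mul_X f i hf => rw [mul_comm, hX, hf, mul_zero]

variable [Fintype σ]

/-- Every exponent `β` of degree `≤ m` has all coordinates `< m + 1`, i.e. is the finitely supported function of
some `f : σ → Fin (m + 1)` (the finite index set used for the evaluation map below).
[cite: EGAIV4, Thm. 16.11.2 (the index set |q| ≤ m)] -/
theorem exists_fin_exponent_eq {m : ℕ} {β : σ →₀ ℕ} (hβ : β.degree ≤ m) :
    ∃ f : σ → Fin (m + 1), (Finsupp.equivFunOnFinite.symm fun i => (f i : ℕ)) = β :=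
  ⟨fun i => ⟨β i, Nat.lt_succ_of_le ((Finsupp.le_degree i β).trans hβ)⟩, Finsupp.ext fun _ => rfl⟩

/-- **Every `A`-submodule of `Diff^{≤ m}_{A/K}`, `A = K[x_1, …, x_n]`, is finitely generated** when `K` is
Noetherian: evaluation at the monomials `x^β` with all `β_i ≤ m` is an `A`-linear map into the Noetherian module
`A^{(m+1)^n}`, injective on `Diff^{≤ m}` by `eq_zero_of_isDiffOpLE_of_apply_monomial_eq_zero`.
[cite: EGAIV4, Thm. 16.11.2 (Diff^m of 𝔸ⁿ is a free module of finite rank)] -/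
theorem fg_of_le_diffOp_mvPolynomial [IsNoetherianRing K]
    {P : Submodule (MvPolynomial σ K) (MvPolynomial σ K →ₗ[K] MvPolynomial σ K)} {m : ℕ}
    (hP : P ≤ diffOp K (MvPolynomial σ K) m) : P.FG := by
  let ev : (MvPolynomial σ K →ₗ[K] MvPolynomial σ K) →ₗ[MvPolynomial σ K]
      ((σ → Fin (m + 1)) → MvPolynomial σ K) :=
    LinearMap.pi fun f : σ → Fin (m + 1) =>
      LinearMap.applyₗ' (MvPolynomial σ K)
        (monomial (Finsupp.equivFunOnFinite.symm fun i => (f i : ℕ)) (1 : K))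
  have hinj : Function.Injective (ev.domRestrict P) := by
    intro x y hxy
    apply Subtype.ext
    rw [← sub_eq_zero]
    refine eq_zero_of_isDiffOpLE_of_apply_monomial_eq_zero m (IsDiffOpLE.sub (hP x.2) (hP y.2))
      fun β hβ => ?_
    obtain ⟨f, rfl⟩ := exists_fin_exponent_eq hβ
    have := congrFun hxy f
    simp only [LinearMap.domRestrict_apply, ev, LinearMap.pi_apply, LinearMap.applyₗ'_apply_apply] at this
    rw [LinearMap.sub_apply, this, sub_self]
  have : Module.Finite (MvPolynomial σ K) P := Module.Finite.of_injective _ hinj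
  exact Module.Finite.iff_fg.1 this

/-- In particular **`Diff^{≤ m}_{K[x_1,…,x_n]/K}` is a finitely generated `K[x_1,…,x_n]`-module** (`K` Noetherian).
[cite: EGAIV4, Thm. 16.11.2] -/
theorem diffOp_mvPolynomial_fg [IsNoetherianRing K] (m : ℕ) : (diffOp K (MvPolynomial σ K) m).FG :=
  fg_of_le_diffOp_mvPolynomial le_rfl

end AffineSpace

end Literature.AlgebraicGeometry.Resolution

end
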